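import Summits.AtomisticToContinuum.BoseEinsteinCondensation.Theorems.BECThomsonPrincipleFibreConductanceStubTransport
import Summits.AtomisticToContinuum.BoseEinsteinCondensation.Theorems.BECThomsonPrincipleFibreConductanceStubBetaCorrector
import Summits.AtomisticToContinuum.BoseEinsteinCondensation.Theorems.BECThomsonPrincipleFibreConductanceStubParsevalShell
import HarnessLib

/-!
# Crux `FibreConductance` (stmt-AtomisticToContinuum-9480), line `parseval-shell-bootstrap`:
# the crux REDUCED to its two landscape statements and its infrared input

With the deterministic stubs of the line landed — `stub_transport` (transport flow along the conditional
amplitude, exact cost `L²/(4π²|n|₂²)`, weak divergence `q + ε♭ + ε♮`, gluing of the two correctors),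
`stub_parsevalShell` (`ShellOccupation → FlatBound`: the bath-averaged flat corrector energy of the
gradient charge is an occupation sum, paid by `Σ_q n_q = N` off the resonant shell and by the shell input
plus the lattice count on it) and `stub_betaCorrector` (`DensityFlattening → ShellOccupation →
BetaCorrectorBound`, Cauchy–Schwarz in the bath) — the bookkeeping composition `stub_compose` of
`Theorems/BECThomsonPrincipleDefs.lean` turns the crux into an implication from exactly three statements,
all quantified over EXACT zero-free minimisers and all (H1)-load-bearing (the standing disprover's landed
`not_gradientComparabilityNearMinimiser`, `not_densityFlatteningNearMinimiser`,
`not_shellOccupationNearMinimiser`, `not_fibreConductanceNearMinimiser`):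

* `GradientComparability` — landscape half for the oscillating (gradient) charge: a weighted corrector of
  `ε♭` at cost `≤ K·(bath-averaged flat energy) + K L²/‖n‖²` (two-scale comparability of the ground-state
  landscape; needs N-uniform Harnack / local-number control of `Ψ₀`, not in the tree);
* `DensityFlattening` — landscape half, k-free: the conditional density `ψ(·|X̂)²` can be driven to `L⁻³`
  by fibre flows with `E_W[D²] ≤ K L²` (cage moments of the exact ground state, not in the tree);
* `ShellOccupation` — the infrared input at minimal strength: single-mode occupations `≤ K·N/(‖n‖²p₁)` on
  the resonant shell `‖p + n‖ < p₁ ≤ min(θ√ρ L/2π, ‖n‖/2)` (thermodynamic-limit information on exact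
  ground states; what the crux itself forces next to `−k` by Thomson duality — InfraredNecessity).

This file records that reduction as one kernel-checked implication (registered sub-goal
`fibreConductance_of_landscape_and_infrared` of stmt-AtomisticToContinuum-9480).
-/

noncomputable section

namespace Summit.AtomisticToContinuum.BoseEinsteinCondensation.Cruxes.FibreConductance.ParsevalShellBootstrap

open Summit.AtomisticToContinuum.BoseEinsteinCondensation.Theses.BECThomsonPrinciple (FibreConductance)

/-- **`FibreConductance` reduced to its open content.** The crux of route `BECThomsonPrinciple`
(`Theses.BECThomsonPrinciple.FibreConductance`, by name) follows from the two landscape statements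
`GradientComparability`, `DensityFlattening` and the infrared input `ShellOccupation` of the line
`parseval-shell-bootstrap` — everything else (transport identity, fibre Parseval bookkeeping, β-channel
Cauchy–Schwarz, fibre regularity and Fubini) is proved in the tree. -/
theorem fibreConductance_of_landscape_and_infrared : GradientComparability → DensityFlattening → ShellOccupation → FibreConductance :=
  fun g d s => stub_compose stub_transport stub_parsevalShell stub_betaCorrector g d s

end Summit.AtomisticToContinuum.BoseEinsteinCondensation.Cruxes.FibreConductance.ParsevalShellBootstrap

end
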